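import Literature.Geometry.Riemannian.GurskyViaclovskyClosednessLimit
import Literature.Geometry.Riemannian.GurskyViaclovskyClosednessProofs
import HarnessLib

/-!
# Gursky–Viaclovsky closedness: "the `C²` estimate implies uniform ellipticity", quantitatively

Support file (everything PROVED; no definition of a notion, no named fact) for the named fact
`Literature.Geometry.Riemannian.gurskyViaclovsky_pathClosed_weighted_four` (Gursky–Viaclovsky,
J. Differential Geom. 63 (2003), Prop. 6: "Since `f(x) > 0`, the `C²` estimate implies uniform
ellipticity, and the `C^{2,α}` estimate then follows from the work of [Krylov] and [Evans] on
concave, uniformly elliptic equations"). This file makes the quoted sentence a theorem in the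
tree's vocabulary, i.e. it verifies the STRUCTURE CONDITION (i)' of the Evans–Krylov theorem
(Gilbarg–Trudinger 2001, §17.4, (17.43) and Thm. 17.14) for the background form of the weighted
`σ₂` path equation along the solutions of the fact's hypothesis:

* `framePoly`, `backgroundPathOperator_eq_framePoly` — the background operator is a fixed
  polynomial `𝒫_t` of the frame `2`-jet `(H_{ab}, b_a) = (Hess_g w(e_a,e_b), dw(e_a))` of `w` in
  a `g`-orthonormal frame (coefficients: `σ₂(A_g)`, `R_g`, `|W_g|²`, `Ric_g(e_a,e_b)` at the point;
  `backgroundPathOperator_eq_frame` of the Limit file);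
* `gvMatrix`, `framePoly_eq_sigma2_gvMatrix` — **`𝒫_t(H, b) = 4σ₂(B) − ¼|W|²`** for the frame
  array `B = ½(Ric − (t/6)R δ) − H − ((1−t)/2)(tr H)δ + b ⊗ b − ((2−t)/2)|b|²δ`, Gursky–Viaclovsky's
  `g⁻¹A^t_u` for `u = −w` (§1, (change1): `A^t_u = A^t_g + ∇²u + ((1−t)/2)(Δu)g + du ⊗ du −
  ((2−t)/2)|∇u|²g`, `A^t_g = ½(Ric − (t/6)R g)`), and `sigma1_gvMatrix`:
  `σ₁(B) = ((3−2t)/6)·(R − 6 tr H − 6|b|²)` (`= ((3−2t)/6)·backgroundScalar`);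
* `framePoly_add`, `hasDerivAt_framePoly` — **the linearisation in the Hessian variables**:
  `𝒫_t(H + ρ) = 𝒫_t(H) − 4⟨L^t(B), ρ⟩ + [quadratic in ρ]`, `L^t(B) = T₁(B) + ((1−t)/2)σ₁(T₁(B))δ`
  the operator of Gursky–Viaclovsky's Def. 2 / Prop. 2 (`ellOp` of the Proofs file); so the
  symbol of the equation in the `u`-variables on `ξ` is `4 Σ L^t(B)_{ab} ξ_a ξ_b`;
* `uniformlyElliptic_along_solution` — **uniform ellipticity along admissible bounded solutions**:
  if `backgroundPathOperator g t (−u) x = q(x) e^{4u(x)}`, `backgroundScalar g (−u) x > 0`,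
  `t ≤ 1`, `|t| ≤ T`, `|u x| ≤ C`, the frame entries of `du`, `Hess u`, `Ric` and `R` are bounded
  by `√C`, `√C`, `P`, `P`, and `q x ≥ q₀ > 0`, then
  `λ Σξ² ≤ Σ L^t(B)_{ab}ξ_aξ_b ≤ Λ Σξ²` with `λ, Λ > 0` depending only on `(q₀, C, P, T)`
  (`σ₂(B) ≥ q₀e^{−4C}/4` from the equation and `|W|² ≥ 0`, `σ₁(B) > 0` from admissibility,
  `|B| ≤ K(C, P, T)`, and `uniformlyElliptic_ellOp` of the Proofs file — Gursky–Viaclovsky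
  Prop. 1 (ii) made quantitative). Concavity in the Hessian variables (GT's (ii)') is
  `concave_sqrt_sigma2` of the Proofs file read through `framePoly_eq_sigma2_gvMatrix`.

## References

* M. J. Gursky, J. A. Viaclovsky, J. Differential Geom. 63 (2003) 131–154, §1 (change1),
  §2 Def. 2 and Prop. 1–2, Prop. 6. [GurskyViaclovsky2003]
* D. Gilbarg, N. S. Trudinger, *Elliptic Partial Differential Equations of Second Order* (2001),
  §17.4, (17.43) and Thm. 17.14. [GilbargTrudinger2001]
-/

noncomputable section

open scoped Manifold ContDiff Topology
open Set Filter Function Module Finset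

namespace Literature.Geometry.Riemannian.GurskyViaclovskyPath

open Literature.Geometry.Lorentzian (PseudoRiemannianMetric)
open Literature.Geometry.Lorentzian.PseudoRiemannianMetric
open Literature.Geometry.Lorentzian
open Literature.Geometry.Riemannian.GurskyViaclovsky

/-! ### The frame polynomial and Gursky–Viaclovsky's matrix -/

section Algebra

/-- **The frame polynomial `𝒫_t`** of `backgroundPathOperator_eq_frame`: the background operator
as a polynomial in the frame `2`-jet `(H, b)` with the curvature data `(σ, R, W, Rc)` of the
background metric at the point as coefficients. [cite: GurskyViaclovsky2003, §1 (change1)–(PDE)] -/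
def framePoly (t σ R W : ℝ) (Rc H : Fin 4 → Fin 4 → ℝ) (b : Fin 4 → ℝ) : ℝ :=
  σ + (2 * ∑ a, ∑ c, Rc a c * H a c - R * ∑ a, H a a)
    + 2 * ((∑ a, H a a) ^ 2 - ∑ a, ∑ c, H a c ^ 2 - ∑ a, ∑ c, Rc a c * (b a * b c))
    + 2 * ((∑ a, H a a) * (∑ a, b a ^ 2) + 2 * ∑ a, ∑ c, H a c * (b a * b c))
    - 1 / 4 * W
    + (1 - t) * (2 - t) * (R - 6 * ∑ a, H a a - 6 * ∑ a, b a ^ 2) ^ 2 / 6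

/-- **Gursky–Viaclovsky's matrix** `B = g⁻¹A^t_u` in a `g`-orthonormal frame, written in the
`w = −u` variables `H = Hess_g w`, `b = dw`:
`B_{ac} = ½(Rc_{ac} − (t/6)R δ_{ac}) − H_{ac} − ((1−t)/2)(tr H)δ_{ac} + b_ab_c − ((2−t)/2)|b|²δ_{ac}`.
[cite: GurskyViaclovsky2003, §1 (change1)] -/
def gvMatrix (t R : ℝ) (Rc H : Fin 4 → Fin 4 → ℝ) (b : Fin 4 → ℝ) : Fin 4 → Fin 4 → ℝ :=
  fun a c ↦ 1 / 2 * (Rc a c - t * R / 6 * frameDelta a c) - H a c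
    - (1 - t) / 2 * (∑ i, H i i) * frameDelta a c + b a * b c
    - (2 - t) / 2 * (∑ i, b i ^ 2) * frameDelta a c

/-- `B` is symmetric when `Rc` and `H` are. [folklore] -/
theorem gvMatrix_symm {t R : ℝ} {Rc H : Fin 4 → Fin 4 → ℝ} (hRc : ∀ a c, Rc a c = Rc c a)
    (hH : ∀ a c, H a c = H c a) (b : Fin 4 → ℝ) (a c : Fin 4) :
    gvMatrix t R Rc H b a c = gvMatrix t R Rc H b c a := by
  simp only [gvMatrix, hRc a c, hH a c, frameDelta_comm a c, mul_comm (b a) (b c)]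

/-- **`σ₁(B) = ((3−2t)/6)(R − 6 tr H − 6|b|²)`** — `((3−2t)/6)·backgroundScalar` in the frame
(`backgroundScalar_eq_frame`); Gursky–Viaclovsky: `σ₁(g⁻¹A^t_u) = e^{−2u}(3−2t)R_{g̃}/6`.
[cite: GurskyViaclovsky2003, §3, proof of Prop. 3] -/
theorem sigma1_gvMatrix (t : ℝ) {R : ℝ} {Rc : Fin 4 → Fin 4 → ℝ} (hR : ∑ a, Rc a a = R)
    (H : Fin 4 → Fin 4 → ℝ) (b : Fin 4 → ℝ) :
    sigma1 (gvMatrix t R Rc H b) =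
      (3 - 2 * t) / 6 * (R - 6 * ∑ a, H a a - 6 * ∑ a, b a ^ 2) := by
  subst hR
  simp only [sigma1, gvMatrix, Fin.sum_univ_four, frameDelta, Fin.isValue, if_true]
  ring

/-- **`𝒫_t(H, b) = 4σ₂(B) − ¼|W|²`**: the frame polynomial is four times `σ₂` of
Gursky–Viaclovsky's matrix minus the Weyl term, when `σ = σ₂(Rc − (R/6)δ)` (the frame value of
`σ₂(A_g)`, `sigma2WeylSchoutenFrame`) and `R = tr Rc` (a polynomial identity; the tree's
dictionary `exp_mul_pathOperator_eq_backgroundPathOperator` in frame form).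
[cite: GurskyViaclovsky2003, §1 (change1)–(PDE)] -/
theorem framePoly_eq_sigma2_gvMatrix (t W : ℝ) {R : ℝ} {Rc H : Fin 4 → Fin 4 → ℝ}
    (hRc : ∀ a c, Rc a c = Rc c a) (hH : ∀ a c, H a c = H c a) (hR : ∑ a, Rc a a = R)
    (b : Fin 4 → ℝ) :
    framePoly t (sigma2 fun a c ↦ Rc a c - R / 6 * frameDelta a c) R W Rc H b =
      4 * sigma2 (gvMatrix t R Rc H b) - W / 4 := by
  have hA : ∀ a c, (fun a c ↦ Rc a c - R / 6 * frameDelta a c) a c =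
      (fun a c ↦ Rc a c - R / 6 * frameDelta a c) c a := fun a c ↦ by
    simp only [hRc a c, frameDelta_comm a c]
  rw [sigma2_eq hA, sigma2_eq (gvMatrix_symm hRc hH b)]
  subst hR
  simp only [framePoly, sigma1, frameNormSq, gvMatrix, Fin.sum_univ_four, frameDelta, Fin.isValue,
    if_true, Fin.reduceEq, if_false, hRc 1 0, hRc 2 0, hRc 3 0, hRc 2 1, hRc 3 1, hRc 3 2,
    hH 1 0, hH 2 0, hH 3 0, hH 2 1, hH 3 1, hH 3 2]
  ring

/-- **Linearisation of `𝒫_t` in the Hessian variables**: for `R = tr Rc`,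
`𝒫_t(H + ρ) = 𝒫_t(H) − 4⟨L^t(B), ρ⟩ + 2(7 − 9t + 3t²)(tr ρ)² − 2|ρ|²`, where
`L^t(B) = T₁(B) + ((1−t)/2)σ₁(T₁(B))δ` (`ellOp`) is the operator of Gursky–Viaclovsky's Def. 2 at
`B = gvMatrix` — "the first Newton transformation is what arises from differentiation of `σ₂`".
[cite: GurskyViaclovsky2003, §2, Def. 2 and Prop. 2] -/
theorem framePoly_add (t σ W : ℝ) {R : ℝ} {Rc : Fin 4 → Fin 4 → ℝ} (hR : ∑ a, Rc a a = R)
    (H ρ : Fin 4 → Fin 4 → ℝ) (b : Fin 4 → ℝ) :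
    framePoly t σ R W Rc (H + ρ) b = framePoly t σ R W Rc H b
      - 4 * frameInner (ellOp t (gvMatrix t R Rc H b)) ρ
      + (2 * (7 - 9 * t + 3 * t ^ 2) * (∑ a, ρ a a) ^ 2 - 2 * frameNormSq ρ) := by
  subst hR
  simp only [framePoly, frameInner, frameNormSq, ellOp, newtonT1, sigma1, gvMatrix, Pi.add_apply,
    Fin.sum_univ_four, frameDelta, Fin.isValue, if_true, Fin.reduceEq, if_false]
  ring

/-- The pairing of an array with `ξ ⊗ ξ` is its quadratic form. [folklore] -/
theorem frameInner_vecMulVec (L : Fin 4 → Fin 4 → ℝ) (ξ : Fin 4 → ℝ) :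
    frameInner L (fun a c ↦ ξ a * ξ c) = quadForm L ξ := by
  simp only [frameInner, quadForm, mul_assoc]

/-- **The symbol of `𝒫_t` in the Hessian variables**: the derivative of
`ε ↦ 𝒫_t(H + ε ξ ⊗ ξ)` at `0` is `−4 Σ L^t(B)_{ab} ξ_a ξ_b` (so, in the `u = −w` variables, the
symbol is `+4·quadForm (ellOp t B) ξ`). [cite: GurskyViaclovsky2003, §2, Prop. 2] -/
theorem hasDerivAt_framePoly (t σ W : ℝ) {R : ℝ} {Rc : Fin 4 → Fin 4 → ℝ} (hR : ∑ a, Rc a a = R)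
    (H : Fin 4 → Fin 4 → ℝ) (b ξ : Fin 4 → ℝ) :
    HasDerivAt (fun ε : ℝ ↦ framePoly t σ R W Rc (H + ε • fun a c ↦ ξ a * ξ c) b)
      (-4 * quadForm (ellOp t (gvMatrix t R Rc H b)) ξ) 0 := by
  set L := quadForm (ellOp t (gvMatrix t R Rc H b)) ξ with hL
  set Q := 2 * (7 - 9 * t + 3 * t ^ 2) * (∑ a, ξ a * ξ a) ^ 2
    - 2 * frameNormSq (fun a c ↦ ξ a * ξ c) with hQ
  have hexp : ∀ ε : ℝ, framePoly t σ R W Rc (H + ε • fun a c ↦ ξ a * ξ c) b =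
      framePoly t σ R W Rc H b + (-4 * L) * ε + Q * ε ^ 2 := by
    intro ε
    rw [framePoly_add t σ W hR H _ b]
    have h1 : frameInner (ellOp t (gvMatrix t R Rc H b)) (ε • fun a c ↦ ξ a * ξ c) = ε * L := by
      rw [hL, ← frameInner_vecMulVec]
      simp only [frameInner, Pi.smul_apply, smul_eq_mul, Finset.mul_sum]
      refine Finset.sum_congr rfl fun a _ ↦ Finset.sum_congr rfl fun c _ ↦ by ring
    have h2 : (∑ a, (ε • fun a c ↦ ξ a * ξ c) a a) = ε * ∑ a, ξ a * ξ a := by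
      simp only [Pi.smul_apply, smul_eq_mul, Finset.mul_sum]
    have h3 : frameNormSq (ε • fun a c ↦ ξ a * ξ c) = ε ^ 2 * frameNormSq (fun a c ↦ ξ a * ξ c) := by
      simp only [frameNormSq, Pi.smul_apply, smul_eq_mul, Finset.mul_sum]
      refine Finset.sum_congr rfl fun a _ ↦ Finset.sum_congr rfl fun c _ ↦ by ring
    rw [h1, h2, h3, hQ]
    ring
  have h1 : HasDerivAt (fun ε : ℝ ↦ -4 * L * ε) (-4 * L) 0 := by
    simpa using (hasDerivAt_id (0 : ℝ)).const_mul (-4 * L)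
  have h2 : HasDerivAt (fun ε : ℝ ↦ Q * ε ^ 2) 0 0 := by
    simpa using (hasDerivAt_pow 2 (0 : ℝ)).const_mul Q
  have hfun : (fun ε : ℝ ↦ framePoly t σ R W Rc (H + ε • fun a c ↦ ξ a * ξ c) b) =
      fun ε ↦ framePoly t σ R W Rc H b + (-4 * L * ε + Q * ε ^ 2) := by
    funext ε
    rw [hexp]
    ring
  rw [hfun]
  have h := (h1.add h2).const_add (framePoly t σ R W Rc H b)
  rwa [add_zero] at h

/-- Entrywise bounds give a Frobenius bound: `|B_{ac}| ≤ K₀` for all entries implies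
`|B|² ≤ (4K₀)²`. [folklore] -/
theorem frameNormSq_le_of_entry_le {B : Fin 4 → Fin 4 → ℝ} {K₀ : ℝ}
    (hB : ∀ a c, |B a c| ≤ K₀) : frameNormSq B ≤ (4 * K₀) ^ 2 := by
  have h : ∀ a c, B a c ^ 2 ≤ K₀ ^ 2 := fun a c ↦ by
    rw [← sq_abs]
    exact pow_le_pow_left₀ (abs_nonneg _) (hB a c) 2
  calc frameNormSq B = ∑ a, ∑ c, B a c ^ 2 := rfl
    _ ≤ ∑ _a : Fin 4, ∑ _c : Fin 4, K₀ ^ 2 := Finset.sum_le_sum fun a _ ↦ Finset.sum_le_sum fun c _ ↦ h a c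
    _ = (4 * K₀) ^ 2 := by simp; ring

/-- **Entry bound for Gursky–Viaclovsky's matrix** from bounds on the frame data:
`|Rc_{ac}| ≤ P`, `|R| ≤ P`, `|H_{ac}| ≤ √C`, `|b_a| ≤ √C`, `|t| ≤ T`.
[cite: GurskyViaclovsky2003, §1 (change1)] -/
theorem abs_gvMatrix_le {t R P C T : ℝ} {Rc H : Fin 4 → Fin 4 → ℝ} {b : Fin 4 → ℝ} (hC : 0 ≤ C)
    (hT : |t| ≤ T) (hRc : ∀ a c, |Rc a c| ≤ P) (hRP : |R| ≤ P)
    (hH : ∀ a c, |H a c| ≤ Real.sqrt C) (hb : ∀ a, |b a| ≤ Real.sqrt C) (a c : Fin 4) :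
    |gvMatrix t R Rc H b a c| ≤
      (1 + T) * P + (3 + 2 * T) * Real.sqrt C + (5 + 2 * T) * C := by
  have hP : 0 ≤ P := (abs_nonneg _).trans hRP
  have hT0 : 0 ≤ T := (abs_nonneg _).trans hT
  have hsq : Real.sqrt C ^ 2 = C := Real.sq_sqrt hC
  have hδ : |frameDelta a c| ≤ 1 := by
    unfold frameDelta; split_ifs <;> simp
  have hδ0 : 0 ≤ |frameDelta a c| := abs_nonneg _
  have htrH : |∑ i, H i i| ≤ 4 * Real.sqrt C :=
    (Finset.abs_sum_le_sum_abs _ _).trans (by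
      calc ∑ i, |H i i| ≤ ∑ _i : Fin 4, Real.sqrt C := Finset.sum_le_sum fun i _ ↦ hH i i
        _ = 4 * Real.sqrt C := by simp)
  have hb2 : |∑ i, b i ^ 2| ≤ 4 * C := by
    rw [abs_of_nonneg (Finset.sum_nonneg fun i _ ↦ sq_nonneg (b i))]
    calc ∑ i, b i ^ 2 ≤ ∑ _i : Fin 4, C := Finset.sum_le_sum fun i _ ↦ by
            rw [← sq_abs, ← hsq]
            exact pow_le_pow_left₀ (abs_nonneg _) (hb i) 2
      _ = 4 * C := by simp
  have hbb : |b a * b c| ≤ C := by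
    rw [abs_mul, ← hsq, sq]
    exact mul_le_mul (hb a) (hb c) (abs_nonneg _) (Real.sqrt_nonneg _)
  have h1t : |1 - t| ≤ 1 + T := (abs_sub _ _).trans (by rw [abs_one]; linarith)
  have h2t : |2 - t| ≤ 2 + T := (abs_sub _ _).trans (by rw [abs_two]; linarith)
  -- term by term
  unfold gvMatrix
  have e1 : |1 / 2 * (Rc a c - t * R / 6 * frameDelta a c)| ≤ 1 / 2 * (P + T * P / 6) := by
    rw [abs_mul, abs_of_pos (by norm_num : (0 : ℝ) < 1 / 2)]
    refine mul_le_mul_of_nonneg_left ((abs_sub _ _).trans (add_le_add (hRc a c) ?_)) (by norm_num)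
    rw [abs_mul, abs_div, abs_mul, abs_of_pos (by norm_num : (0 : ℝ) < 6)]
    calc |t| * |R| / 6 * |frameDelta a c| ≤ T * P / 6 * 1 :=
          mul_le_mul (div_le_div_of_nonneg_right (mul_le_mul hT hRP (abs_nonneg _) hT0)
            (by norm_num)) hδ hδ0 (by positivity)
      _ = T * P / 6 := mul_one _
  have e2 : |(1 - t) / 2 * (∑ i, H i i) * frameDelta a c| ≤ (1 + T) / 2 * (4 * Real.sqrt C) := by
    rw [abs_mul, abs_mul, abs_div, abs_two]
    calc |1 - t| / 2 * |∑ i, H i i| * |frameDelta a c| ≤ (1 + T) / 2 * (4 * Real.sqrt C) * 1 :=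
          mul_le_mul (mul_le_mul (div_le_div_of_nonneg_right h1t (by norm_num)) htrH
            (abs_nonneg _) (by positivity)) hδ hδ0 (by positivity)
      _ = (1 + T) / 2 * (4 * Real.sqrt C) := mul_one _
  have e3 : |(2 - t) / 2 * (∑ i, b i ^ 2) * frameDelta a c| ≤ (2 + T) / 2 * (4 * C) := by
    rw [abs_mul, abs_mul, abs_div, abs_two]
    calc |2 - t| / 2 * |∑ i, b i ^ 2| * |frameDelta a c| ≤ (2 + T) / 2 * (4 * C) * 1 :=
          mul_le_mul (mul_le_mul (div_le_div_of_nonneg_right h2t (by norm_num)) hb2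
            (abs_nonneg _) (by positivity)) hδ hδ0 (by positivity)
      _ = (2 + T) / 2 * (4 * C) := mul_one _
  calc |1 / 2 * (Rc a c - t * R / 6 * frameDelta a c) - H a c
        - (1 - t) / 2 * (∑ i, H i i) * frameDelta a c + b a * b c
        - (2 - t) / 2 * (∑ i, b i ^ 2) * frameDelta a c|
      ≤ |1 / 2 * (Rc a c - t * R / 6 * frameDelta a c)| + |H a c|
        + |(1 - t) / 2 * (∑ i, H i i) * frameDelta a c| + |b a * b c|
        + |(2 - t) / 2 * (∑ i, b i ^ 2) * frameDelta a c| := by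
          refine (abs_sub _ _).trans (add_le_add ((abs_add_le _ _).trans (add_le_add
            ((abs_sub _ _).trans (add_le_add (abs_sub _ _) le_rfl)) le_rfl)) le_rfl)
    _ ≤ 1 / 2 * (P + T * P / 6) + Real.sqrt C + (1 + T) / 2 * (4 * Real.sqrt C) + C
        + (2 + T) / 2 * (4 * C) := by
          exact add_le_add (add_le_add (add_le_add (add_le_add e1 (hH a c)) e2) hbb) e3
    _ ≤ (1 + T) * P + (3 + 2 * T) * Real.sqrt C + (5 + 2 * T) * C := by
          nlinarith [Real.sqrt_nonneg C, mul_nonneg hT0 hP, mul_nonneg hT0 hC]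

end Algebra

/-! ### Uniform ellipticity along admissible bounded solutions -/

section Solution

variable {M : Type*} [TopologicalSpace M] [ChartedSpace (EuclideanSpace ℝ (Fin 4)) M]
  [IsManifold (𝓡 4) ∞ M]
  (g : PseudoRiemannianMetric (𝓡 4) ∞ (EuclideanSpace ℝ (Fin 4)) (TangentSpace (𝓡 4) : M → Type _))
  [g.HasLeviCivita]

/-- **The background operator is the frame polynomial of the frame `2`-jet.**
[cite: GurskyViaclovsky2003, §1 (change1)–(PDE)] -/
theorem backgroundPathOperator_eq_framePoly {w : M → ℝ} (hw : ContMDiff (𝓡 4) 𝓘(ℝ) ∞ w) (t : ℝ)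
    {x : M} {e : Fin 4 → TangentSpace (𝓡 4) x} (he : g.IsOrthonormalFrame x e) :
    backgroundPathOperator g t w x =
      framePoly t (g.sigma2WeylSchouten x) (g.scalarCurvature x) (g.weylNormSq x)
        (fun a c ↦ g.ricci x (e a) (e c)) (fun a c ↦ g.hessian w x (e a) (e c))
        (fun a ↦ mvfderiv (𝓡 4) w x (e a)) := by
  rw [backgroundPathOperator_eq_frame g hw t he, framePoly]

/-- `σ₂(A_g)(x)` is `σ₂` of the frame array `Rc − (R/6)δ`. [cite: ChangGurskyYang2003, §1, (1.0)–(1.1)] -/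
theorem sigma2WeylSchouten_eq_sigma2_frame (hg : g.IsRiemannian) {x : M}
    {e : Fin 4 → TangentSpace (𝓡 4) x} (he : g.IsOrthonormalFrame x e) :
    g.sigma2WeylSchouten x =
      sigma2 fun a c ↦ g.ricci x (e a) (e c) - g.scalarCurvature x / 6 * frameDelta a c := by
  have hE : finrank ℝ (EuclideanSpace ℝ (Fin 4)) = 4 := finrank_euclideanSpace_fin
  have hn : (2 : ℕ∞ω) ≤ ((⊤ : ℕ∞) : ℕ∞ω) := WithTop.coe_le_coe.mpr le_top
  have _h := hg
  rw [g.sigma2WeylSchouten_eq_sigma2WeylSchoutenFrame hn hE he]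
  rfl

/-- **"The `C²` estimate implies uniform ellipticity"** (Gursky–Viaclovsky 2003, proof of
Prop. 6), quantitatively, at a point and in a `g`-orthonormal frame. Let `u` be smooth with
`backgroundPathOperator g t (−u) x = q(x)e^{4u(x)}` (the background form of the weighted path
equation), `backgroundScalar g (−u) x > 0` (admissibility), `t ≤ 1`, `|t| ≤ T`, and bounds
`|u x| ≤ C`, `|∇u|²_g(x) ≤ C`, `|∇²u|²_g(x) ≤ C`, `|Ric_g|²(x) ≤ P²`, `|R_g(x)| ≤ P`, `q x ≥ q₀ > 0`.
Then Gursky–Viaclovsky's matrix `B = g⁻¹A^t_u` (frame array `gvMatrix` of the `w = −u` jet)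
satisfies `λ Σξ² ≤ Σ L^t(B)_{ab} ξ_aξ_b ≤ Λ Σξ²` with
`λ = q₀e^{−4C}/(8K)`, `Λ = 3K(2−t)`, `K = 4((1+T)P + (3+2T)√C + (5+2T)C) + 1`: the symbol
`4·quadForm (ellOp t B)` of the equation (`hasDerivAt_framePoly`) is uniformly elliptic with
constants depending only on `(q₀, C, P, T)` — from `σ₂(B) = (q e^{4u} + ¼|W|²)/4 ≥ q₀e^{−4C}/4`
(`framePoly_eq_sigma2_gvMatrix`, `|W|² ≥ 0`), `σ₁(B) = ((3−2t)/6)·backgroundScalar > 0`, the entry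
bound `abs_gvMatrix_le`, and Prop. 1 (ii) in the quantitative form `uniformlyElliptic_ellOp`.
[cite: GurskyViaclovsky2003, Prop. 6 (proof) and §2 Prop. 1 (ii)] -/
theorem uniformlyElliptic_along_solution (hg : g.IsRiemannian) {u : M → ℝ}
    (hu : ContMDiff (𝓡 4) 𝓘(ℝ) ∞ u) {q : M → ℝ} {t q₀ C P T : ℝ} (ht : t ≤ 1) (htT : |t| ≤ T)
    (hq₀ : 0 < q₀) (hC : 0 ≤ C) (hP : 0 ≤ P) {x : M} (hqx : q₀ ≤ q x)
    (heq : backgroundPathOperator g t (fun y ↦ -u y) x = q x * Real.exp (-4 * (-u x)))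
    (hpos : 0 < backgroundScalar g (fun y ↦ -u y) x)
    (hux : |u x| ≤ C) (hgrad : g.gradSq u x ≤ C) (hhess : g.normSq x (g.hessian u x) ≤ C)
    (hRic : g.normSq x (g.ricci x) ≤ P ^ 2) (hR : |g.scalarCurvature x| ≤ P)
    {e : Fin 4 → TangentSpace (𝓡 4) x} (he : g.IsOrthonormalFrame x e) (ξ : Fin 4 → ℝ) :
    q₀ * Real.exp (-4 * C) / 4 /
          (2 * (4 * ((1 + T) * P + (3 + 2 * T) * Real.sqrt C + (5 + 2 * T) * C) + 1)) *
        ∑ a, ξ a ^ 2 ≤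
      quadForm (ellOp t (gvMatrix t (g.scalarCurvature x) (fun a c ↦ g.ricci x (e a) (e c))
        (fun a c ↦ g.hessian (fun y ↦ -u y) x (e a) (e c))
        (fun a ↦ mvfderiv (𝓡 4) (fun y ↦ -u y) x (e a)))) ξ ∧
    quadForm (ellOp t (gvMatrix t (g.scalarCurvature x) (fun a c ↦ g.ricci x (e a) (e c))
        (fun a c ↦ g.hessian (fun y ↦ -u y) x (e a) (e c))
        (fun a ↦ mvfderiv (𝓡 4) (fun y ↦ -u y) x (e a)))) ξ ≤
      3 * (4 * ((1 + T) * P + (3 + 2 * T) * Real.sqrt C + (5 + 2 * T) * C) + 1) * (2 - t) *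
        ∑ a, ξ a ^ 2 := by
  have hE : finrank ℝ (EuclideanSpace ℝ (Fin 4)) = 4 := finrank_euclideanSpace_fin
  have hn : (2 : ℕ∞ω) ≤ ((⊤ : ℕ∞) : ℕ∞ω) := WithTop.coe_le_coe.mpr le_top
  -- the `w = -u` jet and the curvature data in the frame
  set w : M → ℝ := fun y ↦ -u y with hw_def
  have hw : ContMDiff (𝓡 4) 𝓘(ℝ) ∞ w := hu.neg
  set R := g.scalarCurvature x with hR_def
  set Rc : Fin 4 → Fin 4 → ℝ := fun a c ↦ g.ricci x (e a) (e c) with hRc_def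
  set Hw : Fin 4 → Fin 4 → ℝ := fun a c ↦ g.hessian w x (e a) (e c) with hHw_def
  set bw : Fin 4 → ℝ := fun a ↦ mvfderiv (𝓡 4) w x (e a) with hbw_def
  set K₀ : ℝ := (1 + T) * P + (3 + 2 * T) * Real.sqrt C + (5 + 2 * T) * C with hK₀
  set K : ℝ := 4 * K₀ + 1 with hK
  -- symmetries and the trace of `Rc`
  have hRc : ∀ a c, Rc a c = Rc c a := fun a c ↦ (g.ricci_symm_holds hn x).eq (e a) (e c)
  have hw2 : ContMDiffAt (𝓡 4) 𝓘(ℝ) 2 w x := (hw.of_le hn) x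
  have hH : ∀ a c, Hw a c = Hw c a := fun a c ↦ (g.hessian_symm_holds hw2).eq (e a) (e c)
  have hRsum : ∑ a, Rc a a = R := he.sum_ricci_eq_scalarCurvature g hE
  -- the equation in the frame: `4σ₂(B) − ¼|W|² = q e^{4u}`
  have hframe : framePoly t (g.sigma2WeylSchouten x) R (g.weylNormSq x) Rc Hw bw =
      q x * Real.exp (-4 * (-u x)) := by
    rw [← heq, backgroundPathOperator_eq_framePoly g hw t he]
  have hσ2 : 4 * sigma2 (gvMatrix t R Rc Hw bw) - g.weylNormSq x / 4 =
      q x * Real.exp (-4 * (-u x)) := by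
    rw [← framePoly_eq_sigma2_gvMatrix t (g.weylNormSq x) hRc hH hRsum bw, ← hframe,
      sigma2WeylSchouten_eq_sigma2_frame g hg he]
  -- lower bound for `σ₂(B)`
  have hW : 0 ≤ g.weylNormSq x := g.weylNormSq_nonneg x
  have hexp : Real.exp (-4 * C) ≤ Real.exp (-4 * (-u x)) :=
    Real.exp_le_exp.2 (by linarith [(abs_le.1 hux).1])
  have hc : 0 ≤ q₀ * Real.exp (-4 * C) / 4 := by positivity
  have hcB : q₀ * Real.exp (-4 * C) / 4 ≤ sigma2 (gvMatrix t R Rc Hw bw) := by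
    have h1 : q₀ * Real.exp (-4 * C) ≤ q x * Real.exp (-4 * (-u x)) :=
      mul_le_mul hqx hexp (Real.exp_pos _).le (hq₀.le.trans hqx)
    linarith
  -- positivity of `σ₁(B)`
  have h1 : 0 < sigma1 (gvMatrix t R Rc Hw bw) := by
    rw [sigma1_gvMatrix t hRsum Hw bw, ← backgroundScalar_eq_frame g w he]
    exact mul_pos (by linarith) hpos
  -- entry bounds
  have hP' : ∀ a c, |Rc a c| ≤ P := fun a c ↦ by
    have h := (sq_apply_frame_le_normSq g he (g.ricci x) a c).trans hRic
    have h' := Real.abs_le_sqrt h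
    rwa [Real.sqrt_sq hP] at h'
  have hHu : ∀ a c, Hw a c = -g.hessian u x (e a) (e c) := fun a c ↦ by
    change g.hessian (-u) x (e a) (e c) = _
    rw [g.hessian_neg u x]
    rfl
  have hbu : ∀ a, bw a = -mvfderiv (𝓡 4) u x (e a) := fun a ↦ by
    change mvfderiv (𝓡 4) (-u) x (e a) = _
    rw [mvfderiv_neg]
    rfl
  have hHb : ∀ a c, |Hw a c| ≤ Real.sqrt C := fun a c ↦ by
    rw [hHu, abs_neg]
    exact Real.abs_le_sqrt ((sq_apply_frame_le_normSq g he (g.hessian u x) a c).trans hhess)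
  have hbb : ∀ a, |bw a| ≤ Real.sqrt C := fun a ↦ by
    rw [hbu, abs_neg]
    exact Real.abs_le_sqrt ((sq_mvfderiv_frame_le_gradSq g u he a).trans hgrad)
  have hentry : ∀ a c, |gvMatrix t R Rc Hw bw a c| ≤ K₀ := fun a c ↦
    abs_gvMatrix_le hC htT hP' hR hHb hbb a c
  have hK₀0 : 0 ≤ K₀ := (abs_nonneg _).trans (hentry 0 0)
  have hKpos : 0 < K := by rw [hK]; linarith
  have hBK : frameNormSq (gvMatrix t R Rc Hw bw) ≤ K ^ 2 :=
    (frameNormSq_le_of_entry_le hentry).trans (by rw [hK]; nlinarith)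
  -- Gursky–Viaclovsky Prop. 1 (ii), quantitative form
  have key := uniformlyElliptic_ellOp (gvMatrix_symm hRc hH bw) h1 hc hcB hKpos hBK ht ξ
  have hKdef : K = 4 * ((1 + T) * P + (3 + 2 * T) * Real.sqrt C + (5 + 2 * T) * C) + 1 := by
    rw [hK, hK₀]
  rw [hKdef] at key
  exact key

end Solution

end Literature.Geometry.Riemannian.GurskyViaclovskyPath

end
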